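import Literature.Barriers.CriticalPhenomena.WeaklySAWPerturbativeTransformationBounds
import Mathlib.Analysis.Calculus.InverseFunctionTheorem.ContDiff
import Mathlib.Analysis.Calculus.ContDiff.RCLike
import HarnessLib

/-!
# [BBS-rg-pt, Proposition 4.2.1], the analyticity clauses: `T_j`, `φ_{pt,j}^{(0)}`, `ρ̃_j` are
# polynomial (hence analytic) maps of `ℝ³`, and the inverse `T_j⁻¹` is analytic on the ball

Source: Bauerschmidt–Brydges–Slade, arXiv:1403.7252 [BBS-rg-pt], Proposition 4.2.1 (cited by BBS
2015, §6.1, (e:Tdef)): "There exist an open ball `B ⊂ ℝ³` centred at `0` (independent of `j ≥ 1` and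
`m² ∈ [0, m̄²]`), and analytic maps `ρ_{pt,j} : B → ℝ³` such that, with the quadratic polynomials
`T_j : ℝ³ → ℝ³` …, `T_{j+1} ∘ φ_{pt,j}^{(0)} = φ̄_j ∘ T_j + ρ_{pt,j} ∘ T_j`, `T_j(V) = V + O(|V|²)`, the
inverse `T_j⁻¹` to `T_j` exists on `B` and is analytic with `T_j⁻¹(V) = V + O(|V|²)`, and
`ρ_{pt,j}(V) = O((1+m²L^{2j})^{-k}|V|³)`."

`WeaklySAWPerturbativeTransformationBounds.lean` proves everything in this statement EXCEPT the two
words "analytic" (existence, uniqueness and the bound for `T_j⁻¹` on a uniform ball: `Ttrans_inverse`,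
`exists_Ttrans_inverse`; the identity and the cubic bound: `BBSrgpt_prop421`). This file supplies them:
* `contDiff_Ttrans`, `contDiff_phiPT`, `contDiff_quadMap`, `contDiff_rhoPT` (polynomial maps are `C^ω`)
  and `analyticAt_Ttrans`, `analyticAt_rhoPT`;
* `TtransInv L m² j W` — the inverse of `T_j` on the closed ball `‖U‖ ≤ 1/(32W)` (values in
  `‖V‖ ≤ 1/(16W)`), `TtransInv_spec`, `TtransInv_unique`;
* **`analyticAt_TtransInv`** — `T_j⁻¹` is (real-)analytic at every `U₀` with `‖U₀‖ < 1/(32W)`: the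
  inverse function theorem in the class `C^ω` (Mathlib's `ContDiffAt.to_localInverse`) at
  `V₀ = T_j⁻¹U₀`, where `DT_j(V₀) = 1 + DQ(V₀)` with `‖DQ(V₀)‖ ≤ ½` (`Q = T_j - 1` is `½`-Lipschitz on
  the ball), identified with the global inverse by local uniqueness;
* `analyticAt_rhoPT_comp_TtransInv` — hence the printed `ρ_{pt,j} = ρ̃_j ∘ T_j⁻¹` is analytic on the
  open ball.
Here `W ≥ 1` is any common bound for `|w̄_j^{(1)}|, |w̄_j^{(**)}|` (uniform in `j` and `m² ≥ 0` by
`abs_wbarOne_le`, `abs_wbarStar_le`), so the ball is uniform as printed.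
-/

noncomputable section

open Set Filter Topology Metric
open scoped ContDiff

namespace Literature.Barriers.CriticalPhenomena

namespace CTWSAW

open LongRangePhi4 LongRangePhi4.FRD PT

/-! ### Polynomial maps are `C^ω` -/

/-- `T_j` is `C^n` for every `n` (in particular `C^ω`, i.e. analytic): a quadratic polynomial map.
[cite: BauerschmidtBrydgesSlade2015LogCorr, §6.1 ([BBS-rg-pt] Proposition 4.2.1: "the quadratic polynomials T_j")] -/
theorem contDiff_Ttrans (L s : ℝ) (j : ℕ) {n : WithTop ℕ∞} : ContDiff ℝ n (Ttrans L s j) := by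
  have h0 : ContDiff ℝ n fun V : V3 => V 0 := contDiff_apply ℝ ℝ 0
  have h1 : ContDiff ℝ n fun V : V3 => V 1 := contDiff_apply ℝ ℝ 1
  have h2 : ContDiff ℝ n fun V : V3 => V 2 := contDiff_apply ℝ ℝ 2
  refine contDiff_pi.2 fun i => ?_
  fin_cases i
  · show ContDiff ℝ n fun V => Ttrans L s j V 0
    simp only [Ttrans_apply_zero]
    exact h0.add (((contDiff_const.mul h0).mul h2).mul contDiff_const)
  · show ContDiff ℝ n fun V => Ttrans L s j V 1
    simp only [Ttrans_apply_one]
    exact (h1.add (((contDiff_const.mul h1).mul h2).mul contDiff_const)).add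
      ((contDiff_const.mul (h2.pow 2)).mul contDiff_const)
  · show ContDiff ℝ n fun V => Ttrans L s j V 2
    simp only [Ttrans_apply_two]
    exact h2.add ((h2.pow 2).mul contDiff_const)

/-- `φ̄_j` (the quadratic map `QuadFlowParams.map`) is `C^n` for every `n`. [cite: BauerschmidtBrydgesSlade2015Flow, (1.1)–(1.3)] -/
theorem contDiff_quadMap (P : QuadFlowParams) (j : ℕ) {n : WithTop ℕ∞} : ContDiff ℝ n (P.map j) := by
  have h0 : ContDiff ℝ n fun V : V3 => V 0 := contDiff_apply ℝ ℝ 0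
  have h1 : ContDiff ℝ n fun V : V3 => V 1 := contDiff_apply ℝ ℝ 1
  have h2 : ContDiff ℝ n fun V : V3 => V 2 := contDiff_apply ℝ ℝ 2
  refine contDiff_pi.2 fun i => ?_
  fin_cases i
  · show ContDiff ℝ n fun V => P.map j V 0
    simp only [QuadFlowParams.map_apply_zero]
    exact h0.sub (contDiff_const.mul (h0.pow 2))
  · show ContDiff ℝ n fun V => P.map j V 1
    simp only [QuadFlowParams.map_apply_one]
    exact h1.sub ((contDiff_const.mul (h0.pow 2)).add ((contDiff_const.mul h0).mul h1))
  · show ContDiff ℝ n fun V => P.map j V 2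
    simp only [QuadFlowParams.map_apply_two]
    exact (((contDiff_const.mul h0).add (contDiff_const.mul h1)).add (contDiff_const.mul h2)).sub
      (((((contDiff_const.mul (h0.pow 2)).add ((contDiff_const.mul h0).mul h1)).add
        ((contDiff_const.mul h0).mul h2)).add (contDiff_const.mul (h1.pow 2))).add
        ((contDiff_const.mul h1).mul h2))

/-- `φ_{pt,j}^{(0)}` is `C^n` for every `n`: a quadratic polynomial map. [cite: BauerschmidtBrydgesSlade2015LogCorr, §6.1 ("an explicit quadratic map φ_{pt,j}^{(0)} : ℝ³ → ℝ³")] -/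
theorem contDiff_phiPT (L s : ℝ) (j : ℕ) {n : WithTop ℕ∞} : ContDiff ℝ n (phiPT L s j) := by
  have h0 : ContDiff ℝ n fun V : V3 => V 0 := contDiff_apply ℝ ℝ 0
  have h1 : ContDiff ℝ n fun V : V3 => V 1 := contDiff_apply ℝ ℝ 1
  have h2 : ContDiff ℝ n fun V : V3 => V 2 := contDiff_apply ℝ ℝ 2
  have hm : ContDiff ℝ n fun V : V3 => muPlus L s j V := by
    unfold muPlus; exact (contDiff_const.mul h2).add (contDiff_const.mul h0)
  refine contDiff_pi.2 fun i => ?_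
  fin_cases i
  · show ContDiff ℝ n fun V => phiPT L s j V 0
    simp only [phiPT_apply_zero]
    exact (h0.sub (contDiff_const.mul (h0.pow 2))).sub
      ((contDiff_const.mul h0).mul ((hm.mul contDiff_const).sub (h2.mul contDiff_const)))
  · show ContDiff ℝ n fun V => phiPT L s j V 1
    simp only [phiPT_apply_one]
    exact ((h1.sub (contDiff_const.mul (h0.pow 2))).sub
      (contDiff_const.mul (((hm.pow 2).mul contDiff_const).sub ((h2.pow 2).mul contDiff_const)))).sub
      ((contDiff_const.mul h1).mul ((hm.mul contDiff_const).sub (h2.mul contDiff_const)))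
  · show ContDiff ℝ n fun V => phiPT L s j V 2
    simp only [phiPT_apply_two]
    exact ((((((contDiff_const.mul h2).add (contDiff_const.mul
      (h0.add (((contDiff_const.mul h0).mul h2).mul contDiff_const)))).sub
      (contDiff_const.mul (h0.pow 2))).sub ((contDiff_const.mul h0).mul h2)).sub
      ((contDiff_const.mul h0).mul h1)).sub
      (((hm.pow 2).mul contDiff_const).sub ((contDiff_const.mul (h2.pow 2)).mul contDiff_const)))

/-- `ρ̃_j = T_{j+1} ∘ φ_{pt,j}^{(0)} - φ̄_j ∘ T_j` is `C^n` for every `n`. [cite: BauerschmidtBrydgesSlade2015LogCorr, §6.1, (rhoptdef)] -/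
theorem contDiff_rhoPT (L s : ℝ) (j : ℕ) {n : WithTop ℕ∞} : ContDiff ℝ n (rhoPT L s j) := by
  unfold rhoPT
  exact ((contDiff_Ttrans L s (j + 1)).comp (contDiff_phiPT L s j)).sub
    ((contDiff_quadMap (wsawQuadFlow L s) j).comp (contDiff_Ttrans L s j))

/-- `T_j` is analytic. [cite: BauerschmidtBrydgesSlade2015LogCorr, §6.1 ([BBS-rg-pt] Proposition 4.2.1)] -/
theorem analyticAt_Ttrans (L s : ℝ) (j : ℕ) (V : V3) : AnalyticAt ℝ (Ttrans L s j) V :=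
  ((contDiff_Ttrans L s j (n := ω)).contDiffAt).analyticAt

/-- `ρ̃_j` is analytic. [cite: BauerschmidtBrydgesSlade2015LogCorr, §6.1 ([BBS-rg-pt] Proposition 4.2.1: "analytic maps ρ_{pt,j}")] -/
theorem analyticAt_rhoPT (L s : ℝ) (j : ℕ) (V : V3) : AnalyticAt ℝ (rhoPT L s j) V :=
  ((contDiff_rhoPT L s j (n := ω)).contDiffAt).analyticAt

/-! ### The inverse `T_j⁻¹` on the ball and its analyticity -/

open Classical in
/-- **`T_j⁻¹`** on the ball: the unique `V` with `‖V‖ ≤ 1/(16W)` and `T_jV = U` when it exists (it does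
for `‖U‖ ≤ 1/(32W)` under `|w̄_j^{(1)}|, |w̄_j^{(**)}| ≤ W`, `W ≥ 1`: `Ttrans_inverse`); `U` otherwise.
[cite: BauerschmidtBrydgesSlade2015LogCorr, §6.1 ([BBS-rg-pt] Proposition 4.2.1: "the inverse T_j⁻¹ to T_j exists on B")] -/
def TtransInv (L s : ℝ) (j : ℕ) (W : ℝ) (U : V3) : V3 :=
  if h : ∃ V : V3, ‖V‖ ≤ 1 / (16 * W) ∧ Ttrans L s j V = U then Classical.choose h else U

/-- `T_j⁻¹U` is in the ball `1/(16W)`, solves `T_jV = U`, and `‖T_j⁻¹U - U‖ ≤ 8W‖U‖²`, for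
`‖U‖ ≤ 1/(32W)`. [cite: BauerschmidtBrydgesSlade2015LogCorr, §6.1 ([BBS-rg-pt] Proposition 4.2.1: "T_j⁻¹(V) = V + O(|V|²)")] -/
theorem TtransInv_spec {L s : ℝ} {j : ℕ} {W : ℝ} (hW1 : 1 ≤ W) (hw : |wbarOne 4 L s j| ≤ W)
    (hst : |wbarStar 4 L s j| ≤ W) {U : V3} (hU : ‖U‖ ≤ 1 / (32 * W)) :
    ‖TtransInv L s j W U‖ ≤ 1 / (16 * W) ∧ Ttrans L s j (TtransInv L s j W U) = U ∧
      ‖TtransInv L s j W U - U‖ ≤ 8 * W * ‖U‖ ^ 2 := by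
  classical
  obtain ⟨V, hV, hTV, hVU, huniq⟩ := Ttrans_inverse hW1 hw hst U hU
  have hex : ∃ V : V3, ‖V‖ ≤ 1 / (16 * W) ∧ Ttrans L s j V = U := ⟨V, hV, hTV⟩
  have hdef : TtransInv L s j W U = Classical.choose hex := by
    unfold TtransInv; rw [dif_pos hex]
  obtain ⟨h1, h2⟩ := Classical.choose_spec hex
  have heq : Classical.choose hex = V := huniq _ h1 h2
  rw [hdef, heq]
  exact ⟨hV, hTV, hVU⟩

/-- Uniqueness: any `V'` in the ball `1/(16W)` with `T_jV' = U` (`‖U‖ ≤ 1/(32W)`) is `T_j⁻¹U`.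
[cite: BauerschmidtBrydgesSlade2015LogCorr, §6.1 ([BBS-rg-pt] Proposition 4.2.1)] -/
theorem TtransInv_unique {L s : ℝ} {j : ℕ} {W : ℝ} (hW1 : 1 ≤ W) (hw : |wbarOne 4 L s j| ≤ W)
    (hst : |wbarStar 4 L s j| ≤ W) {U : V3} (hU : ‖U‖ ≤ 1 / (32 * W)) {V' : V3}
    (hV' : ‖V'‖ ≤ 1 / (16 * W)) (hT : Ttrans L s j V' = U) : V' = TtransInv L s j W U := by
  obtain ⟨V, -, -, -, huniq⟩ := Ttrans_inverse hW1 hw hst U hU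
  obtain ⟨h1, h2, -⟩ := TtransInv_spec hW1 hw hst hU
  rw [huniq V' hV' hT, huniq _ h1 h2]

/-- `Q = T_j - 1` is `½`-Lipschitz on the closed ball of radius `1/(16W)`.
[cite: BauerschmidtBrydgesSlade2015LogCorr, §6.1 ([BBS-rg-pt] Proposition 4.2.1, T_j(V) = V + O(|V|²))] -/
theorem lipschitzOnWith_Ttrans_sub_self {L s : ℝ} {j : ℕ} {W : ℝ} (hW1 : 1 ≤ W)
    (hw : |wbarOne 4 L s j| ≤ W) (hst : |wbarStar 4 L s j| ≤ W) :
    LipschitzOnWith (Real.toNNReal (1 / 2)) (fun V => Ttrans L s j V - V) (closedBall 0 (1 / (16 * W))) := by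
  refine LipschitzOnWith.of_dist_le' fun V hV V' hV' => ?_
  rw [mem_closedBall_zero_iff] at hV hV'
  rw [dist_eq_norm, dist_eq_norm]
  have := norm_Ttrans_sub_sub_le hw hst hV hV'
  have hW0 : 0 < W := by linarith
  calc ‖(Ttrans L s j V - V) - (Ttrans L s j V' - V')‖ ≤ 8 * W * (1 / (16 * W)) * ‖V - V'‖ := this
    _ = 1 / 2 * ‖V - V'‖ := by field_simp; ring

/-- **[BBS-rg-pt, Proposition 4.2.1]: `T_j⁻¹` is analytic on the open ball `‖U‖ < 1/(32W)`** (by the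
inverse function theorem in the class `C^ω` at `V₀ = T_j⁻¹U₀`, where `DT_j(V₀) = 1 + DQ(V₀)`,
`‖DQ(V₀)‖ ≤ ½`, and local uniqueness of the inverse).
[cite: BauerschmidtBrydgesSlade2015LogCorr, §6.1 ([BBS-rg-pt] Proposition 4.2.1: "the inverse T_j⁻¹ to T_j exists on B and is analytic")] -/
theorem analyticAt_TtransInv {L s : ℝ} {j : ℕ} {W : ℝ} (hW1 : 1 ≤ W) (hw : |wbarOne 4 L s j| ≤ W)
    (hst : |wbarStar 4 L s j| ≤ W) {U₀ : V3} (hU₀ : ‖U₀‖ < 1 / (32 * W)) :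
    AnalyticAt ℝ (TtransInv L s j W) U₀ := by
  have hW0 : 0 < W := by linarith
  set T : V3 → V3 := Ttrans L s j with hT
  set V₀ : V3 := TtransInv L s j W U₀ with hV₀
  obtain ⟨hV₀b, hTV₀, hV₀U⟩ := TtransInv_spec hW1 hw hst hU₀.le
  rw [← hV₀] at hV₀b hTV₀ hV₀U
  -- `V₀` is strictly inside the ball `1/(16W)`
  have hV₀lt : ‖V₀‖ < 1 / (16 * W) := by
    have h1 : ‖V₀‖ ≤ ‖U₀‖ + 8 * W * ‖U₀‖ ^ 2 := by
      have := norm_sub_norm_le V₀ U₀; linarith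
    have h2 : 8 * W * ‖U₀‖ ^ 2 ≤ 8 * W * (1 / (32 * W)) ^ 2 := by
      gcongr
    have h3 : 8 * W * (1 / (32 * W)) ^ 2 = 1 / (128 * W) := by field_simp; ring
    have h4 : 1 / (32 * W) + 1 / (128 * W) < 1 / (16 * W) := by
      rw [div_add_div _ _ (by positivity) (by positivity), div_lt_div_iff₀ (by positivity) (by positivity)]
      nlinarith
    linarith
  -- differentiability
  have hTcd : ContDiff ℝ ω T := contDiff_Ttrans L s j
  have hTd : Differentiable ℝ T := hTcd.differentiable (by simp)
  set Q : V3 → V3 := fun V => T V - V with hQ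
  have hQd : DifferentiableAt ℝ Q V₀ := (hTd V₀).sub differentiableAt_id
  have hQ' : HasFDerivAt Q (fderiv ℝ Q V₀) V₀ := hQd.hasFDerivAt
  have hTV₀' : T V₀ = U₀ := hTV₀
  have hT' : HasFDerivAt T (fderiv ℝ Q V₀ + ContinuousLinearMap.id ℝ V3) V₀ := by
    have := hQ'.add (hasFDerivAt_id V₀)
    have e : Q + id = T := funext fun V => by simp [hQ]
    rwa [e] at this
  -- `‖DQ(V₀)‖ ≤ ½`
  have hQn : ‖fderiv ℝ Q V₀‖ ≤ 1 / 2 := by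
    have hmem : closedBall (0 : V3) (1 / (16 * W)) ∈ 𝓝 V₀ :=
      mem_of_superset (isOpen_ball.mem_nhds (mem_ball_zero_iff.2 hV₀lt)) ball_subset_closedBall
    have := hQ'.le_of_lipschitzOn hmem (lipschitzOnWith_Ttrans_sub_self hW1 hw hst)
    simpa using this
  -- `DT(V₀) = 1 + DQ(V₀)` is injective, hence an isomorphism
  set A : V3 →L[ℝ] V3 := fderiv ℝ Q V₀ + ContinuousLinearMap.id ℝ V3 with hA
  have hAinj : Function.Injective A := by
    intro x y hxy
    have hb : ‖A (x - y)‖ ≥ ‖x - y‖ - ‖fderiv ℝ Q V₀ (x - y)‖ := by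
      have : A (x - y) = fderiv ℝ Q V₀ (x - y) + (x - y) := rfl
      rw [this]
      have := norm_sub_norm_le (x - y) (-(fderiv ℝ Q V₀ (x - y)))
      rw [norm_neg, sub_neg_eq_add, add_comm] at this
      linarith
    have hc : ‖fderiv ℝ Q V₀ (x - y)‖ ≤ 1 / 2 * ‖x - y‖ :=
      (ContinuousLinearMap.le_opNorm _ _).trans (mul_le_mul_of_nonneg_right hQn (norm_nonneg _))
    have h0 : A (x - y) = 0 := by rw [map_sub, hxy, sub_self]
    rw [h0, norm_zero] at hb
    have : ‖x - y‖ ≤ 0 := by linarith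
    exact sub_eq_zero.1 (norm_le_zero_iff.1 this)
  have hAbij : Function.Bijective (A : V3 →ₗ[ℝ] V3) :=
    ⟨hAinj, LinearMap.injective_iff_surjective.1 hAinj⟩
  set e : V3 ≃L[ℝ] V3 := (LinearEquiv.ofBijective (A : V3 →ₗ[ℝ] V3) hAbij).toContinuousLinearEquiv with he
  have hecoe : (e : V3 →L[ℝ] V3) = A := by
    ext x
    rfl
  have hT'e : HasFDerivAt T (e : V3 →L[ℝ] V3) V₀ := by rw [hecoe]; exact hT'
  -- the inverse function theorem in the class `C^ω`
  have hTat : ContDiffAt ℝ ω T V₀ := hTcd.contDiffAt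
  have hn : (ω : WithTop ℕ∞) ≠ 0 := by simp
  have hg : ContDiffAt ℝ ω (hTat.localInverse hT'e hn) (T V₀) := hTat.to_localInverse hT'e hn
  -- the global inverse is a left inverse of `T` near `V₀`
  have hleft : ∀ᶠ V in 𝓝 V₀, TtransInv L s j W (T V) = V := by
    have h1 : ∀ᶠ V in 𝓝 V₀, ‖V‖ < 1 / (16 * W) :=
      (continuous_norm.continuousAt (x := V₀)).eventually (gt_mem_nhds hV₀lt)
    have h2 : ∀ᶠ V in 𝓝 V₀, ‖T V‖ < 1 / (32 * W) := by
      have hc : ContinuousAt (fun V => ‖T V‖) V₀ := (continuous_norm.comp hTcd.continuous).continuousAt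
      have : ‖T V₀‖ < 1 / (32 * W) := by rw [hTV₀']; exact hU₀
      exact hc.eventually (gt_mem_nhds this)
    filter_upwards [h1, h2] with V hV hTV
    exact (TtransInv_unique hW1 hw hst hTV.le hV.le rfl).symm
  have huniq := (hTat.hasStrictFDerivAt' hT'e hn).localInverse_unique hleft
  -- conclude
  rw [hTV₀'] at hg huniq
  have hg' : ContDiffAt ℝ ω (TtransInv L s j W) U₀ := hg.congr_of_eventuallyEq huniq
  exact hg'.analyticAt

/-- **The printed `ρ_{pt,j} = ρ̃_j ∘ T_j⁻¹` is analytic on the open ball** `‖U‖ < 1/(32W)`.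
[cite: BauerschmidtBrydgesSlade2015LogCorr, §6.1 ([BBS-rg-pt] Proposition 4.2.1: "analytic maps ρ_{pt,j} : B → ℝ³")] -/
theorem analyticAt_rhoPT_comp_TtransInv {L s : ℝ} {j : ℕ} {W : ℝ} (hW1 : 1 ≤ W)
    (hw : |wbarOne 4 L s j| ≤ W) (hst : |wbarStar 4 L s j| ≤ W) {U₀ : V3} (hU₀ : ‖U₀‖ < 1 / (32 * W)) :
    AnalyticAt ℝ (rhoPT L s j ∘ TtransInv L s j W) U₀ :=
  (analyticAt_rhoPT L s j _).comp (analyticAt_TtransInv hW1 hw hst hU₀)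

end CTWSAW

end Literature.Barriers.CriticalPhenomena
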